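import Mathlib.Probability.Moments.Variance
import Mathlib.MeasureTheory.Measure.Tilted
import Summits.Ventures.YMGap.Thresholds.LatticeBakryEmeryWilson
import Summits.Ventures.YMGap.Thresholds.LatticeBakryEmeryPoincare
import Summits.Ventures.YMGap.Thresholds.SharpUniqueness
import Literature.MathematicalPhysics.QuantumLattice.LatticeGaugeDLRGibbsProofs
import HarnessLib

/-!
# Venture YMGap — UNIFORM POINCARÉ INEQUALITY FOR THE DLR KERNELS of lattice `SU(N)` Yang–Mills at the
# sharp window `|β| < 1/(8d)` (every finite region, every boundary condition), kernel-checked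

HONEST FRAMING: venture file (cell `pub-ymgap`, track (a), seat p2). WHAT THIS IS: for every finite edge
set `E ⊂ ℤ^d`, every exterior configuration `η` and every smooth cylinder function `F = f((U_e)_{e∈E})`,
the DLR kernel `γ_E(·|η) = ymSpecification ρ (Nβ) E η` of 't Hooft-scaled `SU(N)` lattice Yang–Mills
satisfies the Poincaré inequality `Var_{γ_E(·|η)}(F) ≤ (1/K) ∫ Γ(f,f) dγ_E(·|η)` and, for `F`
`L_e`-Lipschitz in the link `e`, `Var ≤ (1/K) ∑_{e∈E} L_e²`, with `K = N/2 - N|β|Λ₀` for ANY regional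
Hessian constant `Λ₀` (`RegionWilsonHessianBound d N Λ₀`), UNIFORMLY in `E` and `η`; with the venture's
kernel constant `Λ₀ = 4d` (`regionWilsonHessianBound_four_d`), `K = N/2 - 4dN|β| > 0 ⟺ |β| < 1/(8d)`.
Hypothesis-free kernel theorems (multi-link Bakry–Émery Poincaré `poincare_gibbs` applied to the
kernel's polynomial potential with the exterior links as constants). This is the POINCARÉ analogue of
the named fact `bakryEmery_kernelLogSobolev` (uniform kernel LSI) and the "uniform spectral gap" input
of the Stroock–Zegarlinski theory (uniform PI ⇔ uniform LSI ⇔ Dobrushin–Shlosman mixing for compact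
continuous spins with finite-range interactions, SZ 1992). WHAT IT IS NOT: no LSI, no mixing /
uniqueness / mass-gap statement is proved here (those need the SZ equivalence as a named fact).

## References

* H. Shen, R. Zhu, X. Zhu, CMP 400 (2023) 805–851, Thm 4.2 / Remark 1.3 ("other boundary conditions").
* D. W. Stroock, B. Zegarlinski, J. Funct. Anal. 104 (1992) 299–326; CMP 144 (1992) 303–323.
-/

noncomputable section

open scoped Matrix ComplexConjugate BigOperators Matrix.Norms.Frobenius ContDiff Topology ProbabilityTheory
open Matrix Complex Finset MeasureTheory Filter ProbabilityTheory
open Literature.MathematicalPhysics.QuantumFieldTheory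
open Literature.MathematicalPhysics.QuantumLattice (fundamentalRep continuous_fundamentalRep LGConfig ZdPlaquette
  plaquettesTouching plaquetteObs plaquetteHolonomyZd wilsonBoundaryAction ymSpecification continuous_wilsonBoundaryAction)
open Literature.Probability.LatticeModels (glueWith glueWith_apply_mem glueWith_apply_not_mem measurable_glueWith)
open Literature.MathematicalPhysics.QuantumFieldTheory.SUNBakryEmery (SUN)

namespace Summit.Ventures.YMGap

namespace LatticeBakryEmery

variable {d N : ℕ}

/-! ### The kernel potential on `(E → M_N(ℂ))` with the exterior links as constants -/

/-- The link matrix at `e`: the variable `Q_e` if `e ∈ E`, the frozen exterior matrix `η_e` otherwise. -/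
def linkOrExt (E : Finset (Literature.MathematicalPhysics.QuantumFieldTheory.ZdEdge d))
    (η : LGConfig d (SUN N)) (Q : Cfg ↥E N) (e : Literature.MathematicalPhysics.QuantumFieldTheory.ZdEdge d) :
    Matrix (Fin N) (Fin N) ℂ :=
  if h : e ∈ E then Q ⟨e, h⟩ else (η e : Matrix (Fin N) (Fin N) ℂ)

/-- The normalised kernel potential `∑_{p ∩ E ≠ ∅} Re tr(w₁ w₂ w₃ᴴ w₄ᴴ)`, `w_k` the link matrix of the
`k`-th link of `p` (variable on `E`, frozen off `E`). -/
def regionPot₀ (E : Finset (Literature.MathematicalPhysics.QuantumFieldTheory.ZdEdge d)) (η : LGConfig d (SUN N)) :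
    Cfg ↥E N → ℝ := fun Q =>
  ∑ p ∈ plaquettesTouching E,
    (linkOrExt E η Q (p.1, p.2.1.1) * linkOrExt E η Q (p.1 + Pi.single p.2.1.1 1, p.2.1.2) *
      (linkOrExt E η Q (p.1 + Pi.single p.2.1.2 1, p.2.1.1))ᴴ * (linkOrExt E η Q (p.1, p.2.1.2))ᴴ).trace.re

/-- **The kernel potential** at 't Hooft coupling `β`: `S_{E,η}(Q) = Nβ · regionPot₀ E η Q`. -/
def regionPot (E : Finset (Literature.MathematicalPhysics.QuantumFieldTheory.ZdEdge d)) (η : LGConfig d (SUN N)) (β : ℝ) :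
    Cfg ↥E N → ℝ := fun Q => (N : ℝ) * β * regionPot₀ E η Q

/-- Constant matrix maps are polynomial of degree `0`. -/
theorem isCPolyMat_const {ι : Type} [Fintype ι] (C : Matrix (Fin N) (Fin N) ℂ) :
    IsCPolyMat (ι := ι) (N := N) 0 fun _ => C := fun a b =>
  ⟨by show (fun _ : Cfg ι N => (C a b).re) ∈ _; exact const_mem_polySpace 0 _,
   by show (fun _ : Cfg ι N => (C a b).im) ∈ _; exact const_mem_polySpace 0 _⟩

/-- Each `linkOrExt` factor is polynomial of degree `≤ 1` in the interior coordinates. -/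
theorem isCPolyMat_linkOrExt (E : Finset (Literature.MathematicalPhysics.QuantumFieldTheory.ZdEdge d)) (η : LGConfig d (SUN N))
    (e : Literature.MathematicalPhysics.QuantumFieldTheory.ZdEdge d) :
    IsCPolyMat (ι := ↥E) (N := N) 1 fun Q => linkOrExt E η Q e := by
  by_cases h : e ∈ E
  · have : (fun Q : Cfg ↥E N => linkOrExt E η Q e) = fun Q => Q ⟨e, h⟩ := by
      funext Q; simp [linkOrExt, h]
    rw [this]; exact isCPolyMat_link _
  · have : (fun Q : Cfg ↥E N => linkOrExt E η Q e) = fun _ => (η e : Matrix (Fin N) (Fin N) ℂ) := by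
      funext Q; simp [linkOrExt, h]
    rw [this]
    intro a b
    exact (isCPolyMat_const (ι := ↥E) (η e : Matrix (Fin N) (Fin N) ℂ) a b).mono (Nat.zero_le 1)

/-- `regionPot₀ ∈ 𝒫_4`. -/
theorem regionPot₀_mem_polySpace (E : Finset (Literature.MathematicalPhysics.QuantumFieldTheory.ZdEdge d)) (η : LGConfig d (SUN N)) :
    regionPot₀ (N := N) E η ∈ polySpace ↥E N 4 := by
  have : regionPot₀ (N := N) E η = ∑ p ∈ plaquettesTouching E, fun Q : Cfg ↥E N =>
      (linkOrExt E η Q (p.1, p.2.1.1) * linkOrExt E η Q (p.1 + Pi.single p.2.1.1 1, p.2.1.2) *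
        (linkOrExt E η Q (p.1 + Pi.single p.2.1.2 1, p.2.1.1))ᴴ * (linkOrExt E η Q (p.1, p.2.1.2))ᴴ).trace.re := by
    funext Q; simp only [regionPot₀, Finset.sum_apply]
  rw [this]
  refine Submodule.sum_mem _ fun p _ => ?_
  have h : IsCPolyMat (ι := ↥E) (N := N) (1 + 1 + 1 + 1) fun Q =>
      linkOrExt E η Q (p.1, p.2.1.1) * linkOrExt E η Q (p.1 + Pi.single p.2.1.1 1, p.2.1.2) *
        (linkOrExt E η Q (p.1 + Pi.single p.2.1.2 1, p.2.1.1))ᴴ * (linkOrExt E η Q (p.1, p.2.1.2))ᴴ :=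
    (((isCPolyMat_linkOrExt E η _).mul (isCPolyMat_linkOrExt E η _)).mul
      (isCPolyMat_linkOrExt E η _).conjTranspose).mul (isCPolyMat_linkOrExt E η _).conjTranspose
  exact h.re_trace_mem

/-- `regionPot ∈ 𝒫_4`. -/
theorem regionPot_mem_polySpace (E : Finset (Literature.MathematicalPhysics.QuantumFieldTheory.ZdEdge d)) (η : LGConfig d (SUN N))
    (β : ℝ) : regionPot (N := N) E η β ∈ polySpace ↥E N 4 := by
  have : regionPot (N := N) E η β = ((N : ℝ) * β) • regionPot₀ E η := by
    funext Q; simp only [regionPot, Pi.smul_apply, smul_eq_mul]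
  rw [this]
  exact Submodule.smul_mem _ _ (regionPot₀_mem_polySpace E η)

/-- The kernel potential is smooth. -/
theorem contDiff_regionPot (E : Finset (Literature.MathematicalPhysics.QuantumFieldTheory.ZdEdge d)) (η : LGConfig d (SUN N))
    (β : ℝ) : ContDiff ℝ ∞ (regionPot (N := N) E η β) :=
  contDiff_of_mem_polySpace (regionPot_mem_polySpace E η β)

/-! ### The glued configuration and the boundary Wilson action -/

/-- The glued configuration's link matrices are `linkOrExt` of the interior variables. -/
theorem coe_glueWith_eq_linkOrExt (E : Finset (Literature.MathematicalPhysics.QuantumFieldTheory.ZdEdge d)) (η : LGConfig d (SUN N))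
    (ζ : PSU ↥E N) (e : Literature.MathematicalPhysics.QuantumFieldTheory.ZdEdge d) :
    ((glueWith E ζ η e : SUN N) : Matrix (Fin N) (Fin N) ℂ) = linkOrExt E η (emb ζ) e := by
  by_cases h : e ∈ E
  · rw [glueWith_apply_mem E ζ η h]; simp [linkOrExt, h, emb]
  · rw [glueWith_apply_not_mem E ζ η h]; simp [linkOrExt, h]

/-- **On glued configurations, `-(Nβ) S_E(U) = regionPot E η β (U_E) - N²β · #{p ∩ E ≠ ∅}`**
(`S_E = wilsonBoundaryAction`, fundamental representation; `U⁻¹ = Uᴴ` in `SU(N)`). -/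
theorem neg_mul_wilsonBoundaryAction_glueWith (E : Finset (Literature.MathematicalPhysics.QuantumFieldTheory.ZdEdge d))
    (η : LGConfig d (SUN N)) (β : ℝ) (ζ : PSU ↥E N) :
    -((N : ℝ) * β) * wilsonBoundaryAction (fundamentalRep (Fin N)) E (glueWith E ζ η) =
      regionPot E η β (emb ζ) - (N : ℝ) * β * N * (plaquettesTouching E).card := by
  have hp : ∀ p : ZdPlaquette d, plaquetteObs (fundamentalRep (Fin N)) p.1 p.2.1.1 p.2.1.2 (glueWith E ζ η) =
      (linkOrExt E η (emb ζ) (p.1, p.2.1.1) * linkOrExt E η (emb ζ) (p.1 + Pi.single p.2.1.1 1, p.2.1.2) *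
        (linkOrExt E η (emb ζ) (p.1 + Pi.single p.2.1.2 1, p.2.1.1))ᴴ *
          (linkOrExt E η (emb ζ) (p.1, p.2.1.2))ᴴ).trace.re := by
    intro p
    simp only [plaquetteObs, plaquetteHolonomyZd, map_mul, ← coe_glueWith_eq_linkOrExt]
    rfl
  simp only [wilsonBoundaryAction, regionPot, regionPot₀, hp, Finset.sum_sub_distrib, Finset.sum_const, nsmul_eq_mul]
  ring

/-! ### Kernel expectations as `e^{regionPot}`-weighted product-Haar averages -/

/-- **DLR-kernel expectations as weighted Haar averages**: for a continuous function `F` on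
`ℤ^d`-configurations, `∫ F dγ_E(·|η) = ∫ e^{S(U_E)} F(U_E ∨ η) dσ^{⊗E} / ∫ e^{S} dσ^{⊗E}` with the
polynomial potential `S = regionPot E η β` (the constant `e^{-N²β #P}` cancels; Mathlib `integral_tilted`
and `integral_map`). -/
theorem integral_ymSpecification_eq_div (E : Finset (Literature.MathematicalPhysics.QuantumFieldTheory.ZdEdge d)) (η : LGConfig d (SUN N))
    (β : ℝ) {F : LGConfig d (SUN N) → ℝ} (hF : Continuous F) :
    ∫ U, F U ∂(ymSpecification (fundamentalRep (Fin N)) ((N : ℝ) * β) E η) =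
      (∫ ζ, Real.exp (regionPot E η β (emb ζ)) * F (glueWith E ζ η) ∂(haarPi ↥E N)) /
        ∫ ζ, Real.exp (regionPot E η β (emb ζ)) ∂(haarPi ↥E N) := by
  set C : ℝ := Real.exp (-((N : ℝ) * β * N * (plaquettesTouching E).card)) with hC
  have hCpos : 0 < C := Real.exp_pos _
  have hZ'pos : 0 < ∫ ζ, Real.exp (regionPot E η β (emb ζ)) ∂(haarPi ↥E N) :=
    integral_exp_pos (integrable_of_continuous_PSU
      (Real.continuous_exp.comp (continuous_restrict (contDiff_regionPot E η β))) _)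
  set w : LGConfig d (SUN N) → ℝ := fun U =>
    Real.exp (-((N : ℝ) * β) * wilsonBoundaryAction (fundamentalRep (Fin N)) E U) with hwdef
  have hwc : Continuous w := Real.continuous_exp.comp (continuous_const.mul
    (continuous_wilsonBoundaryAction (fundamentalRep (Fin N)) (continuous_fundamentalRep (n := Fin N)) E))
  have hw : ∀ ζ : PSU ↥E N, w (glueWith E ζ η) = C * Real.exp (regionPot E η β (emb ζ)) := by
    intro ζ
    simp only [hwdef]
    rw [neg_mul_wilsonBoundaryAction_glueWith, ← Real.exp_add]
    congr 1; ring
  have hmeas : Measurable fun ζ : PSU ↥E N => glueWith E ζ η := measurable_glueWith E η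
  unfold ymSpecification
  rw [integral_tilted]
  have hZ : ∫ U, Real.exp ((fun U => -((N : ℝ) * β) * wilsonBoundaryAction (fundamentalRep (Fin N)) E U) U)
      ∂((Measure.pi fun _ : ↥E => haarProbability (SUN N)).map fun ζ => glueWith E ζ η) =
      C * ∫ ζ, Real.exp (regionPot E η β (emb ζ)) ∂(haarPi ↥E N) := by
    rw [integral_map hmeas.aemeasurable hwc.aestronglyMeasurable]
    show ∫ ζ, w (glueWith E ζ η) ∂(haarPi ↥E N) = _
    simp_rw [hw]
    exact integral_const_mul _ _
  rw [hZ, integral_map hmeas.aemeasurable]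
  · show ∫ ζ, (w (glueWith E ζ η) / (C * ∫ ζ, Real.exp (regionPot E η β (emb ζ)) ∂(haarPi ↥E N))) •
        F (glueWith E ζ η) ∂(haarPi ↥E N) = _
    simp_rw [hw, smul_eq_mul]
    rw [eq_div_iff hZ'pos.ne', ← integral_mul_const]
    refine integral_congr_ae (ae_of_all _ fun ζ => ?_)
    have hCne : C ≠ 0 := hCpos.ne'
    have hZne : (∫ ζ, Real.exp (regionPot E η β (emb ζ)) ∂(haarPi ↥E N)) ≠ 0 := hZ'pos.ne'
    field_simp
  · exact ((hwc.div_const _).smul hF).aestronglyMeasurable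

/-! ### The Hessian hypothesis from the tree's `RegionWilsonHessianBound` -/

/-- Along the right flow `t ↦ Q e^{tV}` at `Q ∈ SU(N)^E`, the normalised kernel potential is the tree's
`regionPlaquetteSumAlong E (U_E ∨ η) X` with `X_e = Q_e V_e Q_eᴴ` on `E` and `X_e = 0` off `E`. -/
theorem regionPot₀_emb_mul_exp (E : Finset (Literature.MathematicalPhysics.QuantumFieldTheory.ZdEdge d)) (η : LGConfig d (SUN N))
    (g : PSU ↥E N) (V : Cfg ↥E N) (t : ℝ) :
    regionPot₀ E η (emb g * NormedSpace.exp (t • V)) =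
      regionPlaquetteSumAlong E (glueWith E g η)
        (fun e => if h : e ∈ E then (g ⟨e, h⟩ : Matrix (Fin N) (Fin N) ℂ) * V ⟨e, h⟩ * (g ⟨e, h⟩ : Matrix (Fin N) (Fin N) ℂ)ᴴ
          else 0) t := by
  have hlink : ∀ e : Literature.MathematicalPhysics.QuantumFieldTheory.ZdEdge d,
      linkOrExt E η (emb g * NormedSpace.exp (t • V)) e =
        NormedSpace.exp (t • (if h : e ∈ E then (g ⟨e, h⟩ : Matrix (Fin N) (Fin N) ℂ) * V ⟨e, h⟩ *
            (g ⟨e, h⟩ : Matrix (Fin N) (Fin N) ℂ)ᴴ else 0)) *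
          ((glueWith E g η e : SUN N) : Matrix (Fin N) (Fin N) ℂ) := by
    intro e
    by_cases h : e ∈ E
    · rw [dif_pos h, glueWith_apply_mem E g η h]
      simp only [linkOrExt, dif_pos h, Pi.mul_apply,
        show NormedSpace.exp (t • V) = fun e => NormedSpace.exp ((t • V) e) from Pi.exp_def _, Pi.smul_apply, emb_apply]
      set Ug : Matrix (Fin N) (Fin N) ℂ := (g ⟨e, h⟩ : Matrix (Fin N) (Fin N) ℂ) with hUg
      have hUu : Ug ∈ Matrix.unitaryGroup (Fin N) ℂ := Matrix.specialUnitaryGroup_le_unitaryGroup (g ⟨e, h⟩).2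
      have hstar : star Ug * Ug = 1 := Unitary.star_mul_self_of_mem hUu
      have hstar' : Ug * star Ug = 1 := Unitary.mul_star_self_of_mem hUu
      have hunit : IsUnit Ug := ⟨⟨Ug, star Ug, hstar', hstar⟩, rfl⟩
      have hinv : Ug⁻¹ = star Ug := Matrix.inv_eq_left_inv hstar
      have hconj : t • (Ug * V ⟨e, h⟩ * Ugᴴ) = Ug * (t • V ⟨e, h⟩) * Ug⁻¹ := by
        rw [hinv, Matrix.star_eq_conjTranspose, Matrix.mul_smul, Matrix.smul_mul]
      rw [hconj, Matrix.exp_conj Ug (t • V ⟨e, h⟩) hunit, hinv, Matrix.star_eq_conjTranspose, Matrix.mul_assoc,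
        Matrix.mul_assoc, show Ugᴴ * Ug = 1 from hstar, Matrix.mul_one]
    · rw [dif_neg h, glueWith_apply_not_mem E g η h]
      simp [linkOrExt, h, NormedSpace.exp_zero]
  simp only [regionPot₀, regionPlaquetteSumAlong, hlink]

/-- The second derivative along the right flow, restated with the flow in the product algebra
(as in `LatticeBakryEmeryWilson.iteratedDeriv_two_emb_mul_exp`). -/
theorem iteratedDeriv_two_emb_mul_exp' {ι : Type} [Fintype ι] [DecidableEq ι] {F : Cfg ι N → ℝ}
    (hF : ContDiff ℝ ∞ F) (g : PSU ι N) (V : Cfg ι N) :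
    iteratedDeriv 2 (fun s : ℝ => F (emb g * NormedSpace.exp (s • V))) 0 = algD V (algD V F) (emb g) :=
  iteratedDeriv_two_comp_mul_exp hF (emb g) V

/-- **The Hessian hypothesis for the kernel potential** from the tree's regional Hessian bound:
`RegionWilsonHessianBound d N Λ₀ → HessBound (regionPot E η β) (N|β|Λ₀)`, for every `E` and `η`. -/
theorem hessBound_regionPot {Λ₀ : ℝ} (hH : RegionWilsonHessianBound d N Λ₀)
    (E : Finset (Literature.MathematicalPhysics.QuantumFieldTheory.ZdEdge d)) (η : LGConfig d (SUN N)) (β : ℝ) :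
    HessBound (regionPot E η β) ((N : ℝ) * |β| * Λ₀) := by
  intro g V hV hV0
  set X : Literature.MathematicalPhysics.QuantumFieldTheory.ZdEdge d → Matrix (Fin N) (Fin N) ℂ :=
    fun e => if h : e ∈ E then (g ⟨e, h⟩ : Matrix (Fin N) (Fin N) ℂ) * V ⟨e, h⟩ * (g ⟨e, h⟩ : Matrix (Fin N) (Fin N) ℂ)ᴴ
      else 0 with hX
  have hXskew : ∀ e, (X e)ᴴ = -X e := by
    intro e
    by_cases h : e ∈ E
    · simp only [hX, dif_pos h, conjTranspose_mul, conjTranspose_conjTranspose, hV ⟨e, h⟩, Matrix.mul_neg,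
        Matrix.neg_mul, Matrix.mul_assoc]
    · simp [hX, h]
  have hXtr : ∀ e, (X e).trace = 0 := by
    intro e
    by_cases h : e ∈ E
    · simp only [hX, dif_pos h]
      rw [Matrix.mul_assoc, Matrix.trace_mul_comm, Matrix.mul_assoc,
        show (g ⟨e, h⟩ : Matrix (Fin N) (Fin N) ℂ)ᴴ * (g ⟨e, h⟩ : Matrix (Fin N) (Fin N) ℂ) = 1 from
          Unitary.star_mul_self_of_mem (Matrix.specialUnitaryGroup_le_unitaryGroup (g ⟨e, h⟩).2), Matrix.mul_one,
        hV0 ⟨e, h⟩]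
    · simp [hX, h]
  have hXsupp : ∀ e ∉ E, X e = 0 := fun e he => by simp [hX, he]
  have hflow : (fun s : ℝ => regionPot₀ E η (emb g * NormedSpace.exp (s • V))) =
      regionPlaquetteSumAlong E (glueWith E g η) X := funext fun s => regionPot₀_emb_mul_exp E η g V s
  have hc0 : ContDiff ℝ ∞ (regionPot₀ (N := N) E η) := contDiff_of_mem_polySpace (regionPot₀_mem_polySpace E η)
  have h0 : algD V (algD V (regionPot₀ E η)) (emb g) = iteratedDeriv 2 (regionPlaquetteSumAlong E (glueWith E g η) X) 0 := by
    rw [← iteratedDeriv_two_emb_mul_exp' hc0 g V, hflow]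
  have h1 : algD V (algD V (regionPot E η β)) (emb g) =
      (N : ℝ) * β * iteratedDeriv 2 (regionPlaquetteSumAlong E (glueWith E g η) X) 0 := by
    have : regionPot (N := N) E η β = fun Q => (N : ℝ) * β * regionPot₀ E η Q := rfl
    rw [this, algD_const_mul hc0, algD_const_mul (contDiff_algD hc0 V)]
    show (N : ℝ) * β * algD V (algD V (regionPot₀ E η)) (emb g) = _
    rw [h0]
  rw [h1, abs_mul, abs_mul, Nat.abs_cast]
  have hb := hH E (glueWith E g η) X hXskew hXtr hXsupp
  have hnorm : ∑ e ∈ E, (X e * (X e)ᴴ).trace.re = ∑ e : ↥E, frobNorm (V e) ^ 2 := by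
    rw [← Finset.sum_attach]
    refine sum_congr rfl fun e _ => ?_
    rw [show X (e : Literature.MathematicalPhysics.QuantumFieldTheory.ZdEdge d) =
        (g e : Matrix (Fin N) (Fin N) ℂ) * V e * (g e : Matrix (Fin N) (Fin N) ℂ)ᴴ by simp [hX, e.2],
      ← frobNorm_conj_unitary (Matrix.specialUnitaryGroup_le_unitaryGroup (g e).2) (V e),
      frobNorm_sq_eq_re_trace, Matrix.trace_mul_comm]
  rw [hnorm] at hb
  calc (N : ℝ) * |β| * |iteratedDeriv 2 (regionPlaquetteSumAlong E (glueWith E g η) X) 0|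
      ≤ (N : ℝ) * |β| * (Λ₀ * ∑ e, frobNorm (V e) ^ 2) :=
        mul_le_mul_of_nonneg_left hb (mul_nonneg (Nat.cast_nonneg _) (abs_nonneg _))
    _ = (N : ℝ) * |β| * Λ₀ * ∑ e, frobNorm (V e) ^ 2 := by ring

/-! ### The uniform kernel Poincaré inequality -/

/-- **Kernel Poincaré inequality, Lipschitz form, every region and boundary condition**: for every
finite edge set `E`, exterior `η`, regional Hessian constant `Λ₀` (`RegionWilsonHessianBound d N Λ₀`),
`K = N/2 - N|β|Λ₀ > 0`, and every smooth `f` that is `L_e`-Lipschitz in the link `e` on `SU(N)^E`: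
`Var_{γ_E(·|η)}(f((U_e)_{e∈E})) ≤ (1/K) ∑_{e∈E} L_e²`. Kernel theorem, no named fact. -/
theorem kernel_variance_le {Λ₀ : ℝ} (hH : RegionWilsonHessianBound d N Λ₀) (hN : N ≠ 0) (β : ℝ)
    (hK : 0 < (N : ℝ) / 2 - N * |β| * Λ₀)
    (E : Finset (Literature.MathematicalPhysics.QuantumFieldTheory.ZdEdge d)) (η : LGConfig d (SUN N))
    {f : Cfg ↥E N → ℝ} (hf : ContDiff ℝ ∞ f) {Lc : ↥E → ℝ} (hL : ∀ e, 0 ≤ Lc e) (hLip : LinkLipschitz f Lc) :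
    Var[matrixCylinder E f; ymSpecification (fundamentalRep (Fin N)) ((N : ℝ) * β) E η] ≤
      1 / ((N : ℝ) / 2 - N * |β| * Λ₀) * ∑ e, Lc e ^ 2 := by
  set γ := ymSpecification (fundamentalRep (Fin N)) ((N : ℝ) * β) E η with hγ
  set S := regionPot E η β with hS
  set Z : ℝ := ∫ ζ, Real.exp (S (emb ζ)) ∂(haarPi ↥E N) with hZ
  have hSc : Continuous fun ζ : PSU ↥E N => S (emb ζ) := continuous_restrict (contDiff_regionPot E η β)
  have hZpos : 0 < Z := integral_exp_pos (integrable_of_continuous_PSU (Real.continuous_exp.comp hSc) _)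
  set F : LGConfig d (SUN N) → ℝ := matrixCylinder E f with hF
  have hFc : Continuous F := by
    refine hf.continuous.comp ?_
    exact continuous_pi fun e => continuous_subtype_val.comp (continuous_apply _)
  have hFglue : ∀ ζ : PSU ↥E N, F (glueWith E ζ η) = f (emb ζ) := by
    intro ζ
    simp only [hF, matrixCylinder]
    congr 1
    funext e
    rw [glueWith_apply_mem E ζ η e.2, emb_apply]
  set m : ℝ := (∫ ζ, Real.exp (S (emb ζ)) * f (emb ζ) ∂(haarPi ↥E N)) / Z with hm
  have hmean : ∫ U, F U ∂γ = m := by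
    rw [hγ, integral_ymSpecification_eq_div E η β hFc]
    simp only [hFglue]
    rfl
  have hvar : Var[F; γ] = (∫ ζ, Real.exp (S (emb ζ)) * (f (emb ζ) - m) ^ 2 ∂(haarPi ↥E N)) / Z := by
    rw [variance_eq_integral hFc.measurable.aemeasurable, hmean, hγ,
      integral_ymSpecification_eq_div E η β (F := fun U => (F U - m) ^ 2) ((hFc.sub continuous_const).pow 2)]
    simp only [hFglue]
    rfl
  have hK' : 0 < (N : ℝ) / 2 - (N : ℝ) * |β| * Λ₀ := hK
  have hP := poincare_gibbs_lipschitz (ι := ↥E) hN (regionPot_mem_polySpace E η β) (hessBound_regionPot hH E η β)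
    hK' hf hL hLip
  rw [hvar, div_le_iff₀ hZpos]
  rw [one_div, inv_mul_eq_div, div_mul_eq_mul_div, le_div_iff₀ hK', mul_comm]
  exact hP

/-- **Kernel Poincaré inequality, gradient (Dirichlet-form) form**: `Var_{γ_E(·|η)}(f) ≤ (1/K) ∫ Γ(f,f) dγ_E(·|η)`
(`Γ` the carré du champ of the product Hilbert–Schmidt metric on `SU(N)^E`), uniformly in `E`, `η` —
the uniform spectral gap `≥ K` of the DLR-kernel Glauber–Langevin dynamics. Kernel theorem, no named fact. -/
theorem kernel_variance_le_integral_Gam {Λ₀ : ℝ} (hH : RegionWilsonHessianBound d N Λ₀) (hN : N ≠ 0) (β : ℝ)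
    (hK : 0 < (N : ℝ) / 2 - N * |β| * Λ₀)
    (E : Finset (Literature.MathematicalPhysics.QuantumFieldTheory.ZdEdge d)) (η : LGConfig d (SUN N))
    {f : Cfg ↥E N → ℝ} (hf : ContDiff ℝ ∞ f) :
    Var[matrixCylinder E f; ymSpecification (fundamentalRep (Fin N)) ((N : ℝ) * β) E η] ≤
      1 / ((N : ℝ) / 2 - N * |β| * Λ₀) *
        ∫ U, matrixCylinder E (Gam f f) U ∂(ymSpecification (fundamentalRep (Fin N)) ((N : ℝ) * β) E η) := by
  set γ := ymSpecification (fundamentalRep (Fin N)) ((N : ℝ) * β) E η with hγ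
  set S := regionPot E η β with hS
  set Z : ℝ := ∫ ζ, Real.exp (S (emb ζ)) ∂(haarPi ↥E N) with hZ
  have hSc : Continuous fun ζ : PSU ↥E N => S (emb ζ) := continuous_restrict (contDiff_regionPot E η β)
  have hZpos : 0 < Z := integral_exp_pos (integrable_of_continuous_PSU (Real.continuous_exp.comp hSc) _)
  have hcyl : ∀ (u : Cfg ↥E N → ℝ), Continuous u → Continuous (matrixCylinder E u) := by
    intro u hu
    refine hu.comp ?_
    exact continuous_pi fun e => continuous_subtype_val.comp (continuous_apply _)
  have hFc : Continuous (matrixCylinder E f) := hcyl f hf.continuous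
  have hGc : Continuous (matrixCylinder E (Gam f f)) := hcyl _ (contDiff_Gam hf hf).continuous
  have hglue : ∀ (u : Cfg ↥E N → ℝ) (ζ : PSU ↥E N), matrixCylinder E u (glueWith E ζ η) = u (emb ζ) := by
    intro u ζ
    simp only [matrixCylinder]
    congr 1
    funext e
    rw [glueWith_apply_mem E ζ η e.2, emb_apply]
  set m : ℝ := (∫ ζ, Real.exp (S (emb ζ)) * f (emb ζ) ∂(haarPi ↥E N)) / Z with hm
  have hmean : ∫ U, matrixCylinder E f U ∂γ = m := by
    rw [hγ, integral_ymSpecification_eq_div E η β hFc]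
    simp only [hglue]
    rfl
  have hvar : Var[matrixCylinder E f; γ] = (∫ ζ, Real.exp (S (emb ζ)) * (f (emb ζ) - m) ^ 2 ∂(haarPi ↥E N)) / Z := by
    rw [variance_eq_integral hFc.measurable.aemeasurable, hmean, hγ,
      integral_ymSpecification_eq_div E η β (F := fun U => (matrixCylinder E f U - m) ^ 2)
        ((hFc.sub continuous_const).pow 2)]
    simp only [hglue]
    rfl
  have hG : ∫ U, matrixCylinder E (Gam f f) U ∂γ = (∫ ζ, Real.exp (S (emb ζ)) * Gam f f (emb ζ) ∂(haarPi ↥E N)) / Z := by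
    rw [hγ, integral_ymSpecification_eq_div E η β hGc]
    simp only [hglue]
    rfl
  have hK' : 0 < (N : ℝ) / 2 - (N : ℝ) * |β| * Λ₀ := hK
  have hP := poincare_gibbs (ι := ↥E) hN (regionPot_mem_polySpace E η β) (hessBound_regionPot hH E η β) hK' hf
  rw [hvar, hG, div_le_iff₀ hZpos, one_div, inv_mul_eq_div, div_mul_eq_mul_div, le_div_iff₀ hK',
    div_mul_cancel₀ _ hZpos.ne', mul_comm]
  exact hP

/-- **The sharp window for the kernels**: with the venture's kernel regional Hessian constant `Λ₀ = 4d`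
(`regionWilsonHessianBound_four_d`): for `d ≥ 1`, `N ≥ 1`, `|β| < 1/(8d)`, EVERY finite region `E`,
EVERY exterior `η`, every smooth per-link-Lipschitz `f`:
`Var_{γ_E(·|η)}(f) ≤ (1/(N/2 - 4dN|β|)) ∑_{e∈E} L_e²` — the uniform (in volume AND boundary condition)
Poincaré inequality of the DLR kernels, hypothesis-free. -/
theorem uniform_kernel_poincare_sharp (hd : 1 ≤ d) (hN : 1 ≤ N) {β : ℝ}
    (hβ : |β| < HessianSharp.sharpThresholdSU d)
    (E : Finset (Literature.MathematicalPhysics.QuantumFieldTheory.ZdEdge d)) (η : LGConfig d (SUN N))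
    {f : Cfg ↥E N → ℝ} (hf : ContDiff ℝ ∞ f) {Lc : ↥E → ℝ} (hL : ∀ e, 0 ≤ Lc e) (hLip : LinkLipschitz f Lc) :
    Var[matrixCylinder E f; ymSpecification (fundamentalRep (Fin N)) ((N : ℝ) * β) E η] ≤
      1 / HessianSharp.sharpBakryEmeryConstSU N d β * ∑ e, Lc e ^ 2 := by
  have hK : 0 < HessianSharp.sharpBakryEmeryConstSU N d β := (HessianSharp.sharpBakryEmeryConstSU_pos_iff hd hN β).2 hβ
  rw [HessianSharp.sharpBakryEmeryConstSU_eq] at hK ⊢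
  exact kernel_variance_le (HessianSharp.regionWilsonHessianBound_four_d (d := d) (N := N)) (by omega) β hK E η hf hL hLip

end LatticeBakryEmery

end Summit.Ventures.YMGap
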